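import Literature.Combinatorics.StablePolynomials.Homogenization
import Literature.AlgebraicGeometry.HyperbolicPolynomials.Garding
import HarnessLib

/-!
# Real stability and hyperbolicity of the homogenization (Borcea–Brändén–Liggett, Prop. 4.3, Thm. 4.5)

Borcea–Brändén–Liggett, *Negative dependence and the geometry of polynomials*, J. Amer. Math. Soc. 22
(2009) 521–567 (arXiv:0707.2340), §4.1 "Symmetric homogenization via Gårding hyperbolic polynomials".
This file is the junction between the tree's stable-polynomial vocabulary
(`Literature.Combinatorics.StablePolynomials`: `IsRealStable`, `homogenize N f`, Thm. 4.5 (1) ⇔ (2) in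
`Homogenization.lean`) and the tree's theory of Gårding hyperbolic polynomials
(`Literature.AlgebraicGeometry.HyperbolicPolynomials`: `IsHyperbolic f e`, the cones
`openHyperbolicityCone f e = {x | ∀ τ ≥ 0, f(x + τe) ≠ 0}` — literally Borcea–Brändén–Liggett's
`C_e(p) = {x ∈ ℝⁿ : p(x + te) ≠ 0, t ≥ 0}` — and `hyperbolicityCone`, with Gårding's theorem
`IsHyperbolic.of_mem_openHyperbolicityCone` = Prop. 4.4 (d) and `convex_openHyperbolicityCone` =
Prop. 4.4 (a) in `Garding.lean`). (The module docstring of `Homogenization.lean` predates this junction: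
its sentence "the tree has no theory of Gårding hyperbolic polynomials" is out of date.)

> **Proposition 4.3.** Let `f ∈ ℝ[z_1, …, z_n]`. Then `f` is real stable if and only if `f_H` is
> hyperbolic with respect to all vectors `e ∈ ℝ^{n+1}` of the form `e = (e_1, …, e_n, 0)`, where `e_i > 0`
> for `1 ≤ i ≤ n`.

> **Theorem 4.5.** Suppose that all the coefficients of `f ∈ ℝ[z_1, …, z_n]` are non-negative. The
> following are equivalent: (1) `f_H` is stable; (2) `f` is stable; (3) `f_H` is hyperbolic with respect
> to some vector `e` with `e_i ≥ 0`, `1 ≤ i ≤ n+1`; (4) `f_H` is hyperbolic with respect to any vector `e`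
> with `e_i > 0`, `1 ≤ i ≤ n+1`.

Conventions. The homogenising variable is `z₀ = X none` of `MvPolynomial (Option σ) ℝ`
(`homogenize N f`, `N ≥ deg f`; `N = deg f` is `f_H` and `homogenize N f = z₀^{N - deg f} f_H` in general).
The vector `(e_1, …, e_n, 0)` is `fun o => o.elim 0 e` and `(z, 1)` is `fun o => o.elim 1 z`.
Hyperbolicity in the tree does not bundle homogeneity; `homogenize N f` is a form of degree `N`
(`isHomogeneous_homogenize`).

## Main results (namespace `Literature.Combinatorics.StablePolynomials`)

* `mem_openHyperbolicityCone_of_coeff_nonneg` — a nonzero real polynomial with non-negative coefficients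
  has the open orthant inside `C_e(F)` for every `e ≥ 0` (the step "`C_e(f_H)` contains the cone
  `ℝ^{n+1}_+`" of the printed proof); `isHyperbolic_of_isHyperbolic_of_coeff_nonneg` — hence such a *form*
  hyperbolic w.r.t. one `e ≥ 0` is hyperbolic w.r.t. every `e > 0` (by Prop. 4.4 (d)).
* `isRealStable_of_forall_isHyperbolic` — a real polynomial hyperbolic w.r.t. every direction of the open
  orthant is real stable (the line criterion, Prop. 2.3 (1) of loc. cit. = the tree's `isRealStable_of_line`).
* **Prop. 4.3**: `IsRealStable.isHyperbolic_homogenize_totalDegree` (⟹), `isRealStable_of_isHyperbolic_homogenize`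
  (⟸, for every `N`), `isRealStable_iff_isHyperbolic_homogenize` (as printed, `N = deg f`).
* **Thm. 4.5**: `IsRealStable.isHyperbolic_homogenize` ((2) ⇒ (4)), `isHyperbolic_homogenize_of_nonneg`
  ((3) ⇒ (4)), `isRealStable_homogenize_of_forall_isHyperbolic` ((4) ⇒ (1)), and the four-clause
  `isRealStable_homogenize_tfae` (for `homogenize N f`, any `N ≥ deg f`; (1) ⇔ (2) is the tree's
  `isRealStable_homogenize_iff`).
* The homogeneous case: `isRealStable_tfae_of_isHomogeneous` — a form with non-negative coefficients is
  real stable iff hyperbolic w.r.t. some `e ≥ 0` iff hyperbolic w.r.t. every `e > 0`.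

All statements are theorems; no definitions and no named facts are introduced.

## References

* [BorceaBrandenLiggett2007] J. Borcea, P. Brändén, T. M. Liggett, *Negative dependence and the geometry of
  polynomials*, J. Amer. Math. Soc. 22 (2009) 521–567; arXiv:0707.2340: §4.1, Prop. 4.3, Prop. 4.4,
  Thm. 4.5 (PDF p. 15).
* [Garding1959] L. Gårding, *An inequality for hyperbolic polynomials*, J. Math. Mech. 8 (1959) 957–965,
  Thm. 2 (the source of Prop. 4.4).
* [Branden2007] P. Brändén, *Polynomials with the half-plane property and matroid theory*, Adv. Math. 216
  (2007), §3 (line criterion for real stability).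
-/

noncomputable section

open MvPolynomial
open Literature.AlgebraicGeometry.HyperbolicPolynomials

namespace Literature.Combinatorics.StablePolynomials

/-! ## §1 Polynomials with non-negative coefficients; the line criterion in hyperbolic language -/

section Nonneg

variable {ι : Type*}

/-- A nonzero real polynomial with non-negative coefficients is positive on the open orthant (local copy
of the private lemma of `Homogenization.lean`). [cite: BorceaBrandenLiggett2007, §4.1 proof of Thm. 4.5] -/
private theorem eval_pos_of_coeff_nonneg_orthant {F : MvPolynomial ι ℝ} (hnn : ∀ m, 0 ≤ coeff m F)
    (hF : F ≠ 0) {x : ι → ℝ} (hx : ∀ i, 0 < x i) : 0 < eval x F := by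
  rw [eval_eq]
  have hne : F.support.Nonempty := Finset.nonempty_of_ne_empty fun h => hF (support_eq_empty.1 h)
  obtain ⟨m, hm⟩ := hne
  refine Finset.sum_pos' (fun m' _ => mul_nonneg (hnn m')
      (Finset.prod_nonneg fun i _ => (pow_pos (hx i) _).le))
    ⟨m, hm, mul_pos ((hnn m).lt_of_ne' (mem_support_iff.1 hm)) (Finset.prod_pos fun i _ => pow_pos (hx i) _)⟩

/-- **"`C_e(f_H)` contains the cone `ℝ^{n+1}_+`"**: for a nonzero real polynomial `F` with non-negative
coefficients and any `e` with `e_i ≥ 0`, every point of the open orthant lies in the open hyperbolicity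
cone `C_e(F) = {x : F(x + te) ≠ 0, t ≥ 0}` — indeed `F(x + te) > 0` there.
[cite: BorceaBrandenLiggett2007, §4.1 proof of Thm. 4.5 ((3) ⇒ (4))] -/
theorem mem_openHyperbolicityCone_of_coeff_nonneg {F : MvPolynomial ι ℝ} (hnn : ∀ m, 0 ≤ coeff m F)
    (hF : F ≠ 0) {e : ι → ℝ} (he : ∀ i, 0 ≤ e i) {x : ι → ℝ} (hx : ∀ i, 0 < x i) :
    x ∈ openHyperbolicityCone F e := fun τ hτ =>
  (eval_pos_of_coeff_nonneg_orthant hnn hF fun i => by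
    simpa only [Pi.add_apply, Pi.smul_apply, smul_eq_mul] using
      add_pos_of_pos_of_nonneg (hx i) (mul_nonneg hτ (he i))).ne'

/-- **Thm. 4.5 (3) ⇒ (4) for a form**: a form `F` with non-negative coefficients which is hyperbolic with
respect to some `e` with `e_i ≥ 0` is hyperbolic with respect to every `x` with `x_i > 0` — `x ∈ C_e(F)` by
`mem_openHyperbolicityCone_of_coeff_nonneg`, and `F` is hyperbolic w.r.t. every vector of `C_e(F)`
(Gårding, Prop. 4.4 (d) = the tree's `IsHyperbolic.of_mem_openHyperbolicityCone`).
[cite: BorceaBrandenLiggett2007, §4.1 Thm. 4.5 ((3) ⇒ (4)) and Prop. 4.4 (d)] -/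
theorem isHyperbolic_of_isHyperbolic_of_coeff_nonneg {F : MvPolynomial ι ℝ} {d : ℕ}
    (hF : F.IsHomogeneous d) (hnn : ∀ m, 0 ≤ coeff m F) {e : ι → ℝ} (he : ∀ i, 0 ≤ e i)
    (h : IsHyperbolic F e) {x : ι → ℝ} (hx : ∀ i, 0 < x i) : IsHyperbolic F x :=
  h.of_mem_openHyperbolicityCone hF (mem_openHyperbolicityCone_of_coeff_nonneg hnn h.ne_zero he hx)

/-- **Hyperbolic with respect to every positive direction ⇒ real stable** (the line criterion for real
stability, Prop. 2.3 (1) of Borcea–Brändén–Liggett = Brändén 2007 §3, read in hyperbolic language; used as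
"(4) ⇒ (1) by Proposition 2.3" in the proof of Thm. 4.5). No homogeneity is needed.
[cite: BorceaBrandenLiggett2007, §4.1 proof of Thm. 4.5 ((4) ⇒ (1))] [cite: Branden2007, §3] -/
theorem isRealStable_of_forall_isHyperbolic {F : MvPolynomial ι ℝ}
    (h : ∀ e : ι → ℝ, (∀ i, 0 < e i) → IsHyperbolic F e) : IsRealStable F :=
  isRealStable_of_line fun a b hb t ht => (h b hb).2 a t (by rwa [eval_map])

/-- **The homogeneous case of Thm. 4.5**: for a form `F` with non-negative coefficients the following are
equivalent: `F` is real stable; `F` is hyperbolic w.r.t. some `e` with `e_i ≥ 0`; `F` is hyperbolic w.r.t.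
every `e` with `e_i > 0` (real stable forms are hyperbolic in positive directions: the tree's
`isHyperbolic_of_isRealStable_of_isHomogeneous`). [cite: BorceaBrandenLiggett2007, §4.1 Thm. 4.5 and
Prop. 4.4 (d)] -/
theorem isRealStable_tfae_of_isHomogeneous {F : MvPolynomial ι ℝ} {d : ℕ} (hF : F.IsHomogeneous d)
    (hnn : ∀ m, 0 ≤ coeff m F) :
    List.TFAE [IsRealStable F,
      ∃ e : ι → ℝ, (∀ i, 0 ≤ e i) ∧ IsHyperbolic F e,
      ∀ e : ι → ℝ, (∀ i, 0 < e i) → IsHyperbolic F e] := by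
  tfae_have 1 → 3 := fun hs e he => isHyperbolic_of_isRealStable_of_isHomogeneous hs hF he
  tfae_have 3 → 2 := fun h => ⟨fun _ => 1, fun _ => zero_le_one, h _ fun _ => one_pos⟩
  tfae_have 2 → 3 := fun ⟨e, he, h⟩ x hx => isHyperbolic_of_isHyperbolic_of_coeff_nonneg hF hnn he h hx
  tfae_have 3 → 1 := fun h => isRealStable_of_forall_isHyperbolic h
  tfae_finish

end Nonneg

/-! ## §2 Proposition 4.3: `f` real stable iff `f_H` hyperbolic w.r.t. all `(e, 0)`, `e > 0` -/

section Prop43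

variable {σ : Type*}

/-- **Prop. 4.3 (⟹)**: if `f` is real stable then `f_H = homogenize (deg f) f` is hyperbolic with respect
to every `(e_1, …, e_n, 0)` with `e_i > 0`. Proof: `f_H(e, 0) = f_d(e) ≠ 0` because the top form `f_d` of
a real stable polynomial is a real stable form (Choe–Oxley–Sokal–Wagner Prop. 2.2, the tree's
`IsRealStable.homogeneousComponent_totalDegree`) and real stable forms do not vanish on the open orthant;
and a zero `z` of `z ↦ f_H((x, x₀) + z(e, 0))` is a zero of `f_d(x + ze)` if `x₀ = 0`, of
`x₀^d f(x/x₀ + (z/x₀) e)` if `x₀ ≠ 0`, so `z` is real by the line criterion for `f_d`, resp. `f`.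
[cite: BorceaBrandenLiggett2007, §4.1 Prop. 4.3] -/
theorem IsRealStable.isHyperbolic_homogenize_totalDegree [Finite σ] {f : MvPolynomial σ ℝ}
    (hf : IsRealStable f) {e : σ → ℝ} (he : ∀ i, 0 < e i) :
    IsHyperbolic (StablePolynomials.homogenize f.totalDegree f) (fun o => o.elim 0 e) := by
  have htop := hf.homogeneousComponent_totalDegree
  refine ⟨?_, fun x z hz => ?_⟩
  · -- `f_H(e, 0) = f_d(e) ≠ 0`
    have h := eval_map_homogenize_of_eq_zero (RingHom.id ℝ) (le_refl f.totalDegree)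
      (w := fun o : Option σ => o.elim (0 : ℝ) e) rfl
    rw [map_id, map_id] at h
    rw [h]
    exact eval_ne_zero_of_isRealStable htop (homogeneousComponent_isHomogeneous _ _) he
  · by_cases hx : x none = 0
    · -- on the hyperplane `x₀ = 0`: a zero of the top form along the line `x + z e`
      have h := eval_map_homogenize_of_eq_zero (algebraMap ℝ ℂ) (le_refl f.totalDegree)
        (w := fun j : Option σ => (x j : ℂ) + z * ((j.elim (0 : ℝ) e : ℝ) : ℂ)) (by simp [hx])
      rw [h] at hz
      simp only [Option.elim_some] at hz
      rw [eval_map] at hz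
      exact htop.im_eq_zero_of_eval₂_line_eq_zero (fun i => x (some i)) he hz
    · -- off the hyperplane: `f_H(x + z(e,0)) = x₀^d f(x/x₀ + (z/x₀) e)`
      have h := eval_map_homogenize_of_ne_zero (algebraMap ℝ ℂ) (le_refl f.totalDegree)
        (w := fun j : Option σ => (x j : ℂ) + z * ((j.elim (0 : ℝ) e : ℝ) : ℂ)) (by simpa using hx)
      rw [h] at hz
      simp only [Option.elim_none, Option.elim_some, Complex.ofReal_zero, mul_zero, add_zero] at hz
      have hz' := (mul_eq_zero.1 hz).resolve_left (pow_ne_zero _ (by exact_mod_cast hx))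
      have hpt : (fun i => ((x (some i) : ℂ) + z * (e i : ℂ)) / (x none : ℂ)) =
          fun i => ((x (some i) / x none : ℝ) : ℂ) + z / (x none : ℂ) * (e i : ℂ) := by
        funext i
        push_cast
        ring
      rw [hpt, eval_map] at hz'
      have him := hf.im_eq_zero_of_eval₂_line_eq_zero (fun i => x (some i) / x none) he hz'
      rw [Complex.div_ofReal_im, div_eq_zero_iff] at him
      exact him.resolve_right hx

/-- **Prop. 4.3 (⟸)**: if `homogenize N f` is hyperbolic with respect to every `(e_1, …, e_n, 0)` with
`e_i > 0`, then `f` is real stable — a zero `z ∈ Hⁿ` of `f` is the zero `i` of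
`t ↦ f_H((Re z, 1) + t (Im z, 0))`, `f_H(z, 1) = f(z)`. (Any `N`; for `N > deg f` the hypothesis is void
since `homogenize N f` vanishes on `z₀ = 0`.) [cite: BorceaBrandenLiggett2007, §4.1 Prop. 4.3] -/
theorem isRealStable_of_isHyperbolic_homogenize {f : MvPolynomial σ ℝ} {N : ℕ}
    (h : ∀ e : σ → ℝ, (∀ i, 0 < e i) → IsHyperbolic (homogenize N f) (fun o => o.elim 0 e)) :
    IsRealStable f := by
  rw [isRealStable_iff]
  intro z hz h0
  have key := (h (fun i => (z i).im) hz).2 (fun o => o.elim 1 fun i => (z i).re) Complex.I ?_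
  · simp at key
  · have hpt : (fun j : Option σ => (((j.elim (1 : ℝ) fun i => (z i).re) : ℝ) : ℂ) +
          Complex.I * (((j.elim (0 : ℝ) fun i => (z i).im) : ℝ) : ℂ)) = fun o => o.elim (1 : ℂ) z := by
      funext o
      cases o with
      | none => simp
      | some i =>
        simp only [Option.elim_some]
        rw [mul_comm, Complex.re_add_im]
    rw [hpt, map_homogenize (RingHom.injective _), eval_homogenize_one, eval_map]
    exact h0

/-- **Proposition 4.3 (Borcea–Brändén–Liggett), as printed**: "`f` is real stable if and only if `f_H` is
hyperbolic with respect to all vectors `e ∈ ℝ^{n+1}` of the form `e = (e_1, …, e_n, 0)`, where `e_i > 0`."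
[cite: BorceaBrandenLiggett2007, §4.1 Prop. 4.3] -/
theorem isRealStable_iff_isHyperbolic_homogenize [Finite σ] (f : MvPolynomial σ ℝ) :
    IsRealStable f ↔
      ∀ e : σ → ℝ, (∀ i, 0 < e i) → IsHyperbolic (homogenize f.totalDegree f) (fun o => o.elim 0 e) :=
  ⟨fun hf _ he => hf.isHyperbolic_homogenize_totalDegree he, isRealStable_of_isHyperbolic_homogenize⟩

end Prop43

/-! ## §3 Theorem 4.5 in full -/

section Thm45

variable {σ : Type*}

/-- **Thm. 4.5 (3) ⇒ (4)**: if `f` has non-negative coefficients and `homogenize N f` (`N ≥ deg f`) is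
hyperbolic with respect to some `e` with `e_i ≥ 0`, then it is hyperbolic with respect to every `e'` with
`e'_i > 0` ("`C_e(f_H)` contains the cone `ℝ^{n+1}_+`, which by Proposition 4.4 (d) proves (4)").
[cite: BorceaBrandenLiggett2007, §4.1 Thm. 4.5 ((3) ⇒ (4))] -/
theorem isHyperbolic_homogenize_of_nonneg {f : MvPolynomial σ ℝ} (hnn : ∀ m, 0 ≤ coeff m f) {N : ℕ}
    (hN : f.totalDegree ≤ N) {e : Option σ → ℝ} (he : ∀ o, 0 ≤ e o) (h : IsHyperbolic (homogenize N f) e)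
    {e' : Option σ → ℝ} (he' : ∀ o, 0 < e' o) : IsHyperbolic (homogenize N f) e' :=
  isHyperbolic_of_isHyperbolic_of_coeff_nonneg (isHomogeneous_homogenize hN) (coeff_homogenize_nonneg hnn N)
    he h he'

/-- **Thm. 4.5 (4) ⇒ (1)**: if `homogenize N f` is hyperbolic with respect to every `e` with `e_i > 0` then it
is real stable ("by Proposition 2.3", the line criterion). [cite: BorceaBrandenLiggett2007, §4.1 Thm. 4.5
((4) ⇒ (1))] -/
theorem isRealStable_homogenize_of_forall_isHyperbolic {f : MvPolynomial σ ℝ} {N : ℕ}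
    (h : ∀ e : Option σ → ℝ, (∀ o, 0 < e o) → IsHyperbolic (homogenize N f) e) :
    IsRealStable (homogenize N f) :=
  isRealStable_of_forall_isHyperbolic h

variable [Fintype σ]

/-- **Thm. 4.5 (2) ⇒ (4)**: if `f` is real stable with non-negative coefficients then `homogenize N f`
(`N ≥ deg f`) is hyperbolic with respect to every `e` with `e_i > 0` (it is a real stable form by the tree's
(2) ⇒ (1) `IsRealStable.homogenize`, and real stable forms are hyperbolic in positive directions).
[cite: BorceaBrandenLiggett2007, §4.1 Thm. 4.5 ((2) ⇒ (4))] -/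
theorem IsRealStable.isHyperbolic_homogenize {f : MvPolynomial σ ℝ} (hf : IsRealStable f)
    (hnn : ∀ m, 0 ≤ coeff m f) {N : ℕ} (hN : f.totalDegree ≤ N) {e : Option σ → ℝ} (he : ∀ o, 0 < e o) :
    IsHyperbolic (StablePolynomials.homogenize N f) e :=
  isHyperbolic_of_isRealStable_of_isHomogeneous (hf.homogenize hnn hN) (isHomogeneous_homogenize hN) he

/-- **Theorem 4.5 (Borcea–Brändén–Liggett), all four clauses**: for `f ∈ ℝ[z_1, …, z_n]` with non-negative
coefficients and `N ≥ deg f` (so that `homogenize N f = z₀^{N - deg f} f_H`), the following are equivalent: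
(1) `homogenize N f` is real stable; (2) `f` is real stable; (3) `homogenize N f` is hyperbolic with respect
to some `e` with `e_i ≥ 0`; (4) `homogenize N f` is hyperbolic with respect to every `e` with `e_i > 0`.
[cite: BorceaBrandenLiggett2007, §4.1 Thm. 4.5] -/
theorem isRealStable_homogenize_tfae {f : MvPolynomial σ ℝ} (hnn : ∀ m, 0 ≤ coeff m f) {N : ℕ}
    (hN : f.totalDegree ≤ N) :
    List.TFAE [IsRealStable (homogenize N f), IsRealStable f,
      ∃ e : Option σ → ℝ, (∀ o, 0 ≤ e o) ∧ IsHyperbolic (homogenize N f) e,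
      ∀ e : Option σ → ℝ, (∀ o, 0 < e o) → IsHyperbolic (homogenize N f) e] := by
  tfae_have 1 → 2 := isRealStable_of_isRealStable_homogenize hN
  tfae_have 2 → 4 := fun hf e he => hf.isHyperbolic_homogenize hnn hN he
  tfae_have 4 → 3 := fun h => ⟨fun _ => 1, fun _ => zero_le_one, h _ fun _ => one_pos⟩
  tfae_have 3 → 4 := fun ⟨e, he, h⟩ e' he' => isHyperbolic_homogenize_of_nonneg hnn hN he h he'
  tfae_have 4 → 1 := fun h => isRealStable_homogenize_of_forall_isHyperbolic h
  tfae_finish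

/-- **Thm. 4.5 (3) ⇒ (2)**: a real polynomial with non-negative coefficients whose homogenization is
hyperbolic with respect to one vector with non-negative entries is real stable.
[cite: BorceaBrandenLiggett2007, §4.1 Thm. 4.5 ((3) ⇒ (2))] -/
theorem isRealStable_of_isHyperbolic_homogenize_of_nonneg {f : MvPolynomial σ ℝ} (hnn : ∀ m, 0 ≤ coeff m f)
    {N : ℕ} (hN : f.totalDegree ≤ N) {e : Option σ → ℝ} (he : ∀ o, 0 ≤ e o)
    (h : IsHyperbolic (homogenize N f) e) : IsRealStable f :=
  isRealStable_of_isRealStable_homogenize hN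
    (isRealStable_homogenize_of_forall_isHyperbolic fun _ he' => isHyperbolic_homogenize_of_nonneg hnn hN he h he')

/-- **Thm. 4.5 (2) ⇔ (3) at the all-ones vector**: `f` (coefficients `≥ 0`) is real stable iff
`homogenize N f` is hyperbolic with respect to `𝟙 = (1, …, 1)`. [cite: BorceaBrandenLiggett2007, §4.1
Thm. 4.5] -/
theorem isRealStable_iff_isHyperbolic_homogenize_one {f : MvPolynomial σ ℝ} (hnn : ∀ m, 0 ≤ coeff m f)
    {N : ℕ} (hN : f.totalDegree ≤ N) : IsRealStable f ↔ IsHyperbolic (homogenize N f) (fun _ => 1) :=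
  ⟨fun hf => hf.isHyperbolic_homogenize hnn hN fun _ => one_pos,
    fun h => isRealStable_of_isHyperbolic_homogenize_of_nonneg hnn hN (fun _ => zero_le_one) h⟩

end Thm45

end Literature.Combinatorics.StablePolynomials
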